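import Literature.Analysis.Complex.PositiveFormsWedgeProducts
import HarnessLib

/-!
# The cones of positive and strongly positive forms: closedness and duality statements

Topic `Literature/Analysis/Complex`; lane `lit-hodgefound` (Track 2 foundations library), prover
seat `lit-hodgefound-p06`, self-claimed row g24-#7; sequel of `PositiveForms.lean` and
`PositiveFormsWedgeProducts.lean` (Demailly, *Complex Analytic and Differential Geometry*, Ch. III
§1.A, pointwise on a complex normed space `V`; "positive" = Criterion III.1.6, "strongly positive" =
Definition III.1.1).

Demailly, III (1.3): "The sets of positive and strongly positive forms are closed convex cones"
and, by Definition 1.1, "the positive cone is the dual of the strongly positive cone" under the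
pairing `Λ^{p,p} × Λ^{q,q} → Λ^{n,n}`, `p + q = n`. Here:

* `isClosed_setOf_isOfTypeAt` — the forms of a given pointwise type `(p,q)` form a closed set
  (each defining identity `u(e^{iθ}v) = e^{i(p-q)θ}u(v)` is closed in the operator-norm topology);
* `isClosed_setOf_isStronglyPositive_one` — **the strongly positive `(1,1)`-forms form a closed
  cone** (finite-dimensional `V`; bidegree `(1,1)`, where strongly positive = positive of type
  `(1,1)`, Cor. III.1.9); likewise in bidegrees `(0,0)` and `(n,n)`
  (`isClosed_setOf_isStronglyPositive_zero`, `isClosed_setOf_isStronglyPositive_top`);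
* `isPositive_iff_forall_isStronglyPositive_wedge` — **duality as in Definition III.1.1**: for
  `dim V = p + q`, a `2p`-form is positive iff its wedge with every STRONGLY POSITIVE `2q`-form
  (not only with the generators `iα₁∧ᾱ₁∧…`) is a positive `(n,n)`-form;
* `IsPositive.wedge_nonneg_apply_complexFrame` — the pairing is `≥ 0`: for `u` positive and `w`
  strongly positive of any degrees, `(u ∧ w)(v₁, I v₁, …) ≥ 0` on every complex frame.

Theorems only; no definitions, no named facts.

## References

* [DemaillyAGBook] J.-P. Demailly, *Complex Analytic and Differential Geometry* (version of June 21,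
  2012), Ch. III §1.A, Def. 1.1, (1.3), Criterion 1.6, Cor. 1.9.
* [Voisin2002] C. Voisin, *Hodge Theory and Complex Algebraic Geometry I* (2002), §2.3.1 (types).
-/

noncomputable section

open scoped ComplexOrder
open Complex Function ContinuousAlternatingMap Module

namespace Literature.Analysis.Complex.PositiveForm

variable {V : Type*} [NormedAddCommGroup V] [NormedSpace ℂ V] {k p q : ℕ}

/-! ### Closedness -/

/-- **The forms of pointwise type `(p,q)` form a closed set** (an intersection of closed
conditions `u(e^{iθ}v) = e^{i(p-q)θ} u(v)`, evaluation being continuous). [cite: Voisin2002, §2.3.1] -/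
theorem isClosed_setOf_isOfTypeAt : IsClosed {u : V [⋀^Fin k]→L[ℝ] ℂ | IsOfTypeAt p q u} := by
  by_cases hk : p + q = k
  · have : {u : V [⋀^Fin k]→L[ℝ] ℂ | IsOfTypeAt p q u} =
        ⋂ θ : ℝ, ⋂ v : Fin k → V, {u | u (fun i ↦ exp (θ * I) • v i) =
          exp (((p : ℤ) - q : ℤ) * θ * I) * u v} := by
      ext u
      simp only [Set.mem_setOf_eq, IsOfTypeAt, hk, true_and, Set.mem_iInter]
    rw [this]
    exact isClosed_iInter fun θ ↦ isClosed_iInter fun v ↦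
      isClosed_eq (continuous_eval_const _) (continuous_const.mul (continuous_eval_const _))
  · have : {u : V [⋀^Fin k]→L[ℝ] ℂ | IsOfTypeAt p q u} = ∅ :=
      Set.eq_empty_of_forall_notMem fun u hu ↦ hk hu.1
    rw [this]
    exact isClosed_empty

/-- **The strongly positive `(1,1)`-forms form a closed cone** (finite-dimensional `V`): in
bidegree `(1,1)` strongly positive = positive of type `(1,1)` (Cor. III.1.9), and both conditions
are closed ((1.3): "the sets of positive and strongly positive forms are closed convex cones").
[cite: DemaillyAGBook, Ch. III (1.3) and Cor. 1.9] -/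
theorem isClosed_setOf_isStronglyPositive_one [FiniteDimensional ℂ V] :
    IsClosed {u : V [⋀^Fin (2 * 1)]→L[ℝ] ℂ | IsStronglyPositive 1 u} := by
  have : {u : V [⋀^Fin (2 * 1)]→L[ℝ] ℂ | IsStronglyPositive 1 u} =
      {u | IsOfTypeAt 1 1 u} ∩ {u | IsPositive 1 u} := by
    ext u; exact isStronglyPositive_one_iff
  rw [this]
  exact isClosed_setOf_isOfTypeAt.inter isClosed_setOf_isPositive

/-- The strongly positive `(0,0)`-forms (the non-negative real constants) form a closed cone.
[cite: DemaillyAGBook, Ch. III (1.3) and Cor. 1.9] -/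
theorem isClosed_setOf_isStronglyPositive_zero :
    IsClosed {u : V [⋀^Fin (2 * 0)]→L[ℝ] ℂ | IsStronglyPositive 0 u} := by
  have : {u : V [⋀^Fin (2 * 0)]→L[ℝ] ℂ | IsStronglyPositive 0 u} = {u | IsPositive 0 u} := by
    ext u; exact isStronglyPositive_zero_iff
  rw [this]
  exact isClosed_setOf_isPositive

/-- The strongly positive `(n,n)`-forms, `n = dim V`, form a closed cone (Cor. III.1.9: in top
degree strongly positive = positive). [cite: DemaillyAGBook, Ch. III (1.3) and Cor. 1.9] -/
theorem isClosed_setOf_isStronglyPositive_top [FiniteDimensional ℂ V] (hn : finrank ℂ V = p) :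
    IsClosed {u : V [⋀^Fin (2 * p)]→L[ℝ] ℂ | IsStronglyPositive p u} := by
  have : {u : V [⋀^Fin (2 * p)]→L[ℝ] ℂ | IsStronglyPositive p u} = {u | IsPositive p u} := by
    ext u; exact (isStronglyPositive_top_iff hn).trans (by rfl)
  rw [this]
  exact isClosed_setOf_isPositive

/-! ### Duality (Definition III.1.1 versus Criterion III.1.6) -/

/-- **Definition III.1.1 ⇔ Criterion III.1.6, with all strongly positive test forms**: for
`dim V = p + q`, a `2p`-form `u` is positive iff `u ∧ w` is a positive `(n,n)`-form for EVERY strongly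
positive `2q`-form `w` ("`u` is positive iff `u ∧ v ≥ 0` for all strongly positive `v` of
complementary bidegree" — the positive cone is the dual of the strongly positive cone).
[cite: DemaillyAGBook, Ch. III Def. 1.1 and Criterion 1.6] -/
theorem isPositive_iff_forall_isStronglyPositive_wedge [FiniteDimensional ℂ V]
    (hn : finrank ℂ V = p + q) (h2 : 2 * p + 2 * q = 2 * (p + q)) {u : V [⋀^Fin (2 * p)]→L[ℝ] ℂ} :
    IsPositive p u ↔ ∀ w : V [⋀^Fin (2 * q)]→L[ℝ] ℂ, IsStronglyPositive q w →
      IsPositive (p + q) ((u.wedge w).domDomCongr (finCongr h2)) :=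
  ⟨fun hu _ hw ↦ hu.wedge_of_isStronglyPositive hn hw h2,
    fun h ↦ (isPositive_iff_forall_isPositive_wedge_elemProd hn h2).2 fun α ↦
      h _ (isStronglyPositive_elemProd α)⟩

/-- **The pairing of the positive and the strongly positive cones is non-negative**: for `u`
positive of degree `2p` and `w` strongly positive of degree `2q` (any `p`, `q`, finite-dimensional
`V`), `(u ∧ w)(v₁, I v₁, …, v_{p+q}, I v_{p+q}) ≥ 0` on every complex frame.
[cite: DemaillyAGBook, Ch. III Def. 1.1 and Prop. 1.11] -/
theorem IsPositive.wedge_nonneg_apply_complexFrame [FiniteDimensional ℂ V]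
    {u : V [⋀^Fin (2 * p)]→L[ℝ] ℂ} (hu : IsPositive p u) {w : V [⋀^Fin (2 * q)]→L[ℝ] ℂ}
    (hw : IsStronglyPositive q w) (h2 : 2 * p + 2 * q = 2 * (p + q)) (v : Fin (p + q) → V) :
    0 ≤ (u.wedge w) (complexFrame v ∘ Fin.cast h2) :=
  hu.wedge_of_isStronglyPositive' hw h2 v

end Literature.Analysis.Complex.PositiveForm

end
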